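import Literature.AlgebraicGeometry.Frobenioids.CircleOpens
import HarnessLib

/-!
# Frobenioids II, Lemma 3.2: proofs of (iii), (x), (xii) (centralizer, semi-direct structure)

Mochizuki, *The geometry of Frobenioids II*, Kyushu J. Math. **62** (2008) 401–460, §3, Lemma 3.2
pp. 25–27 [cite: MochizukiFrdII2008, Lem 3.2 pp.25-27]. Discharges (proof-only companion, additive,
no signature change) of the named facts of `CircleOpens.lean` (abc-iut-L1-t4, p403897) that need no
parametrisation of arcs: `ItemIII`, `ItemX`, `ItemXII_centralizer`, `ItemXII_semidirect`. The
remaining items ((ii), (iv)–(ix), (xi), (xii) divisible/normalizer) use the description of connected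
open subsets of `S¹` as arcs via the covering `ℝ → S¹` and are discharged in sibling files.

Proof notes. (x): a subset homeomorphic to `S¹` is compact, hence closed; a nonempty clopen subset of
the connected space `S¹` is everything. (iii): if `S¹ \ A ∋ p ≠ q` then `S¹ \ {q}` is an
`(A, S¹)`-subset different from `A` and `S¹` (Mathlib: the complement of a point of the circle is
path connected); the converse is set theory. (xii): `α` commuting with all translations is the
translation by `α(1)` (the text's "`z = τ_z(1) = τ_z(α(1)) = α(τ_z(1)) = α(z)`", p. 27); the
semi-direct structure from `φ_{-1} ∘ τ_w = τ_{w⁻¹} ∘ φ_{-1}`.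
-/

namespace Literature.AlgebraicGeometry.Frobenioids

open Set Function Topology
open scoped Pointwise

noncomputable section

namespace CircleOpens

/-! ### Lemma 3.2 (x) -/

/-- **Lemma 3.2 (x)** (FrdII p. 26), PROVED: a connected open `A ≠ S¹` is not homeomorphic to `S¹`
(it would be compact, hence clopen and nonempty in the connected `S¹`).
[cite: MochizukiFrdII2008, Lem 3.2 (x) p.26] -/
theorem ItemX_holds : ItemX := by
  intro A hA hAo hne
  refine ⟨fun h => hne ?_⟩
  haveI : CompactSpace A := h.symm.compactSpace
  have hc : IsCompact A := isCompact_iff_compactSpace.mpr inferInstance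
  rcases isClopen_iff.mp ⟨hc.isClosed, hAo⟩ with h0 | h1
  · exact absurd h0 hA.nonempty.ne_empty
  · exact h1

/-! ### Lemma 3.2 (iii) -/

/-- **Lemma 3.2 (iii)** (FrdII p. 25), PROVED: "`S¹ \ A` is of cardinality `≤ 1` if and only if
there does not exist an `(A, S¹)`-subset `A′` such that `A′ ≠ A, S¹`."
[cite: MochizukiFrdII2008, Lem 3.2 (iii) p.25] -/
theorem ItemIII_holds : ItemIII := by
  intro A hA hAo
  constructor
  · rintro hsub ⟨A', ⟨-, -, hAA', -⟩, hne, hne'⟩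
    apply hne
    refine le_antisymm (fun x hx => ?_) hAA'
    by_contra hxA
    obtain ⟨p, hp⟩ := (ne_univ_iff_exists_notMem A').mp hne'
    have hpA : p ∈ Aᶜ := fun h => hp (hAA' h)
    exact hp ((hsub hxA hpA) ▸ hx)
  · intro H
    by_contra hns
    obtain ⟨p, hp, q, hq, hpq⟩ := Set.not_subsingleton_iff.mp hns
    apply H
    refine ⟨{q}ᶜ, ⟨(Circle.isPathConnected_compl_singleton q).isConnected, isOpen_compl_singleton,
      fun x hx hxq => hq (hxq ▸ hx), subset_univ _⟩, ?_, ?_⟩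
    · intro h
      exact hp (h ▸ (show p ∈ ({q}ᶜ : Set Circle) from hpq))
    · exact (ne_univ_iff_exists_notMem _).mpr ⟨q, fun h => h rfl⟩

/-! ### Lemma 3.2 (xii): translations, the reflection, and their relations -/

/-- `(f * g) z = f (g z)` in `Homeo(S¹)`. [cite: MochizukiFrdII2008, Lem 3.2 (xii) p.26] -/
theorem homeo_mul_apply (f g : Homeo) (z : Circle) : (f * g) z = f (g z) := rfl

/-- `τ_w(z) = w z`. [cite: MochizukiFrdII2008, Lem 3.2 (xii) p.26] -/
@[simp] theorem translation_apply (w z : Circle) : translation w z = w * z := rfl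

/-- `φ_{-1}(z) = z⁻¹`. [cite: MochizukiFrdII2008, Lem 3.2 (xii) p.26] -/
@[simp] theorem inversion_apply (z : Circle) : inversion z = z⁻¹ := rfl

/-- `τ_v ∘ τ_w = τ_{vw}`. [cite: MochizukiFrdII2008, Lem 3.2 (xii) p.26] -/
theorem translation_mul (v w : Circle) : translation v * translation w = translation (v * w) :=
  (translationHom.map_mul v w).symm

/-- `τ_1 = id`. [cite: MochizukiFrdII2008, Lem 3.2 (xii) p.26] -/
theorem translation_one : translation 1 = 1 := translationHom.map_one

/-- `τ_w⁻¹ = τ_{w⁻¹}`. [cite: MochizukiFrdII2008, Lem 3.2 (xii) p.26] -/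
theorem translation_inv (w : Circle) : (translation w)⁻¹ = translation w⁻¹ :=
  (translationHom.map_inv w).symm

/-- `τ_w ∈ Trans(S¹)`. [cite: MochizukiFrdII2008, Lem 3.2 (xii) p.26] -/
theorem translation_mem_trans (w : Circle) : translation w ∈ trans := ⟨w, rfl⟩

/-- `φ_{-1} ∘ φ_{-1} = id`. [cite: MochizukiFrdII2008, Lem 3.2 (xii) p.26] -/
theorem inversion_mul_inversion : inversion * inversion = 1 :=
  Homeomorph.ext fun z => by simp

/-- `φ_{-1}⁻¹ = φ_{-1}`. [cite: MochizukiFrdII2008, Lem 3.2 (xii) p.26] -/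
theorem inversion_inv : inversion⁻¹ = inversion :=
  inv_eq_of_mul_eq_one_right inversion_mul_inversion

/-- `φ_{-1} ∘ τ_w = τ_{w⁻¹} ∘ φ_{-1}` (the relation behind `Refl(S¹) ≅ S¹ ⋊ ℤ/2ℤ`).
[cite: MochizukiFrdII2008, Lem 3.2 (xii) p.26] -/
theorem inversion_mul_translation (w : Circle) :
    inversion * translation w = translation w⁻¹ * inversion :=
  Homeomorph.ext fun z => by
    change (w * z)⁻¹ = w⁻¹ * z⁻¹
    rw [mul_inv_rev, mul_comm]

/-- `τ_w ∘ φ_{-1} ∘ τ_v = τ_{w v⁻¹} ∘ φ_{-1}`. [cite: MochizukiFrdII2008, Lem 3.2 (xii) p.26] -/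
theorem translation_inversion_mul_translation (w v : Circle) :
    translation w * inversion * translation v = translation (w * v⁻¹) * inversion := by
  rw [mul_assoc, inversion_mul_translation, ← mul_assoc, translation_mul]

/-- `(τ_w ∘ φ_{-1})⁻¹ = τ_w ∘ φ_{-1}` (reflections are involutions).
[cite: MochizukiFrdII2008, Lem 3.2 (xii) p.26] -/
theorem translation_mul_inversion_inv (w : Circle) :
    (translation w * inversion)⁻¹ = translation w * inversion := by
  apply inv_eq_of_mul_eq_one_right
  rw [← mul_assoc, translation_inversion_mul_translation, mul_inv_cancel, translation_one, one_mul,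
    inversion_mul_inversion]

/-- `φ_{-1}` is not a translation: otherwise `z ↦ z⁻¹` would be `z ↦ z` (evaluate at `1`), but
`exp(iπ/2)² = exp(iπ) ≠ 1`. [cite: MochizukiFrdII2008, Lem 3.2 (xii) p.26] -/
theorem inversion_notMem_trans : inversion ∉ trans := by
  rintro ⟨w, hw⟩
  have h1 : w = 1 := by
    have := congrArg (fun f : Homeo => f 1) hw
    simpa using this
  subst h1
  have h2 : (Circle.exp (Real.pi / 2))⁻¹ = Circle.exp (Real.pi / 2) := by
    have := congrArg (fun f : Homeo => f (Circle.exp (Real.pi / 2))) hw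
    simpa using this.symm
  apply Circle.exp_pi_ne_one
  have h3 : Circle.exp Real.pi = Circle.exp (Real.pi / 2) * Circle.exp (Real.pi / 2) := by
    rw [← Circle.exp_add]; ring_nf
  rw [h3]
  nth_rw 1 [← h2]
  exact inv_mul_cancel _

/-- **Lemma 3.2 (xii)**, centralizer (FrdII pp. 26–27), PROVED: "the centralizer of `Trans(S¹)` in
`Homeo(S¹)` is equal to `Trans(S¹)`" — an `α` commuting with all translations is `τ_{α(1)}`
("`z = τ_z(1)`, … `α(z) = α(τ_z(1)) = τ_z(α(1))`"). [cite: MochizukiFrdII2008, Lem 3.2 (xii) pp.26-27] -/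
theorem ItemXII_centralizer_holds : ItemXII_centralizer := by
  refine le_antisymm (fun α hα => ?_) trans_le_centralizer_trans
  refine ⟨α 1, Homeomorph.ext fun z => ?_⟩
  have h := hα (translation z) (translation_mem_trans z)
  have hz := congrArg (fun f : Homeo => f 1) h
  simp only [homeo_mul_apply, translation_apply, mul_one] at hz
  rw [translation_apply, mul_comm, hz]

/-- Every element of `Refl(S¹)` is `τ_w` or `τ_w ∘ φ_{-1}` for some `w ∈ S¹`.
[cite: MochizukiFrdII2008, Lem 3.2 (xii) p.26] -/
theorem exists_eq_translation_or_of_mem_refl {f : Homeo} (hf : f ∈ refl) :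
    ∃ w : Circle, f = translation w ∨ f = translation w * inversion := by
  refine Subgroup.closure_induction (p := fun f _ => ∃ w : Circle,
      f = translation w ∨ f = translation w * inversion) ?_ ?_ ?_ ?_ hf
  · rintro g (⟨w, rfl⟩ | hg)
    · exact ⟨w, Or.inl rfl⟩
    · rw [mem_singleton_iff] at hg
      exact ⟨1, Or.inr (by rw [hg, translation_one, one_mul])⟩
  · exact ⟨1, Or.inl translation_one.symm⟩
  · rintro g h - - ⟨v, rfl | rfl⟩ ⟨w, rfl | rfl⟩
    · exact ⟨v * w, Or.inl (translation_mul v w)⟩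
    · exact ⟨v * w, Or.inr (by rw [← mul_assoc, translation_mul])⟩
    · exact ⟨v * w⁻¹, Or.inr (translation_inversion_mul_translation v w)⟩
    · refine ⟨v * w⁻¹, Or.inl ?_⟩
      rw [← mul_assoc, translation_inversion_mul_translation, mul_assoc, inversion_mul_inversion,
        mul_one]
  · rintro g - ⟨w, rfl | rfl⟩
    · exact ⟨w⁻¹, Or.inl (translation_inv w)⟩
    · exact ⟨w, Or.inr (translation_mul_inversion_inv w)⟩

/-- `τ_w ∘ φ_{-1} ∈ Refl(S¹)`. [cite: MochizukiFrdII2008, Lem 3.2 (xii) p.26] -/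
theorem translation_mul_inversion_mem_refl (w : Circle) : translation w * inversion ∈ refl :=
  refl.mul_mem (trans_le_refl (translation_mem_trans w)) inversion_mem_refl

/-- Conjugating a translation by an element of `Refl(S¹)` gives a translation.
[cite: MochizukiFrdII2008, Lem 3.2 (xii) p.26] -/
theorem conj_translation_mem_trans {f : Homeo} (hf : f ∈ refl) (v : Circle) :
    f * translation v * f⁻¹ ∈ trans := by
  obtain ⟨w, rfl | rfl⟩ := exists_eq_translation_or_of_mem_refl hf
  · rw [translation_mul, translation_inv, translation_mul]
    exact translation_mem_trans _
  · rw [translation_mul_inversion_inv, translation_inversion_mul_translation,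
      ← mul_assoc (translation (w * v⁻¹) * inversion), translation_inversion_mul_translation,
      mul_assoc, inversion_mul_inversion, mul_one]
    exact translation_mem_trans _

/-- **Lemma 3.2 (xii)**, "`Refl(S¹) ≅ S¹ ⋊ (ℤ/2ℤ)`" (FrdII p. 26), PROVED in the internal rendering of
`CircleOpens.ItemXII_semidirect`: `Trans(S¹) ◁ Refl(S¹)`, `φ_{-1} ∉ Trans(S¹)`, `φ_{-1}² = 1`, and
`Refl(S¹) = Trans(S¹) ⊔ Trans(S¹) φ_{-1}`. [cite: MochizukiFrdII2008, Lem 3.2 (xii) p.26] -/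
theorem ItemXII_semidirect_holds : ItemXII_semidirect := by
  refine ⟨⟨?_⟩, inversion_notMem_trans, inversion_mul_inversion, fun f hf => ?_⟩
  · rintro ⟨n, hn⟩ hn' ⟨g, hg⟩
    rw [Subgroup.mem_subgroupOf] at hn' ⊢
    obtain ⟨v, rfl⟩ := hn'
    exact conj_translation_mem_trans hg v
  · obtain ⟨w, h | h⟩ := exists_eq_translation_or_of_mem_refl hf
    · exact ⟨translation w, translation_mem_trans w, Or.inl h⟩
    · exact ⟨translation w, translation_mem_trans w, Or.inr h⟩

/-! ### Lemma 3.2 (viii) -/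

/-- The complement of a point is an `(A, B)`-subset whenever the point misses `A` and `B = S¹`.
[cite: MochizukiFrdII2008, Lem 3.2 (viii) p.26] -/
theorem isSub_compl_singleton {A : Set Circle} {p : Circle} (hp : p ∉ A) :
    IsSub A univ {p}ᶜ :=
  ⟨(Circle.isPathConnected_compl_singleton p).isConnected, isOpen_compl_singleton,
    fun _ hx hxp => hp (hxp ▸ hx), subset_univ _⟩

/-- **Lemma 3.2 (viii)** (FrdII p. 26), PROVED: "Suppose that `B \ A` is of cardinality `> 1`. Then
there exist `(A, B)`-subsets `A₁`, `A₂` such that `B = A₁ ∪ A₂`, `A₁ ≠ S¹`, `A₂ ≠ S¹`." If `B ≠ S¹`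
take `A₁ = A₂ = B`; if `B = S¹` take the complements of two distinct points of `S¹ \ A`.
[cite: MochizukiFrdII2008, Lem 3.2 (viii) p.26] -/
theorem ItemVIII_holds : ItemVIII := by
  intro A B hAB hBA
  by_cases hB : B = univ
  · subst hB
    obtain ⟨p, hp, q, hq, hpq⟩ := hBA
    refine ⟨{p}ᶜ, {q}ᶜ, isSub_compl_singleton hp.2, isSub_compl_singleton hq.2, ?_, ?_, ?_⟩
    · ext x
      simp only [mem_univ, mem_union, mem_compl_iff, mem_singleton_iff, true_iff]
      by_cases hx : x = p
      · exact Or.inr (hx ▸ hpq)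
      · exact Or.inl hx
    · exact (ne_univ_iff_exists_notMem _).mpr ⟨p, fun h => h rfl⟩
    · exact (ne_univ_iff_exists_notMem _).mpr ⟨q, fun h => h rfl⟩
  · exact ⟨B, B, isSub_right hAB, isSub_right hAB, (union_self B).symm, hB, hB⟩

end CircleOpens

end

end Literature.AlgebraicGeometry.Frobenioids
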